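import Summits.Ventures.QEC.Thresholds.PlanarSurfaceCodeSAWThresholds
import Literature.InformationTheory.QuantumCodes.CSSEquivalenceDecoders
import HarnessLib

/-!
# Planar surface codes, code capacity, SAW-counting threshold — II: the second sector by self-duality, both sectors,
# and the depolarizing corollary `p_c^depol(planar) > .0535` — unconditional, tier CERTIFIED (kernel)

Venture QEC, `Summits/Ventures/QEC/Thresholds/` (LADDER-QEC rung Q5, PARTITION row 09; qec-type-09 gen 6, cell item 135
«09.PSAW»; companion of `PlanarSurfaceCodeSAWThresholds.lean`, which certifies `p_c > .0357` for every minimum-weight / MWPM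
decoder family of the `H_X`-sector of lit-2's planar surface codes `HGP(H, Hᵀ)`). Here:

| theorem | statement | tier |
|---|---|---|
| `planarPullback`, `planarFailureFamily'_eq_pullback`, `planarPullback_isMinWeight`, `planar_isThresholdLowerBound'_of_unprimed` | the `X ↔ Z` exchange of the planar code is the planar code re-indexed by the coordinate swaps (lit-2's `planarHGPCode_swap_eq_reindex`), so every `H_Z`-sector decoder is the transport of its PULL-BACK, with the same failure probability and minimum weight preserved (`CSSCode.zFailure_pullback`, `isMinWeight_zPullback`): a bound for EVERY min-weight family of the `H_X`-sector transfers to the `H_Z`-sector | CERTIFIED (kernel) |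
| ★ `planar_isThresholdLowerBound'_kernelSymmK16`, `planar_accuracyThreshold'_gt_0357`, `planar_mwpm_isThresholdLowerBound'_kernelSymmK16` | SECOND SECTOR (`H_Z`-checks, smooth edges as boundary): **`p_c > .0357`**, every minimum-weight / boundary-MWPM family (was `.0285`) | CERTIFIED (kernel), unconditional |
| `planar_bothSectors_belowThreshold_0357` | both sectors at once below `.0357` | CERTIFIED (kernel), unconditional |
| ★ `planar_depolarizing_isThresholdLowerBound_kernelSymmK16`, `planar_depolarizing_accuracyThreshold_gt_0535`, `planar_depolarizing_accuracyThreshold_minWeight_gt_0535` | DEPOLARIZING noise, sector-wise minimum-weight decoding: threshold `≥ (3/2)·p₀(2.6939)`, **`p_c^depol(planar) > .0535`** (was `.0427`; the exact `3/2` marginal-rate rule `depolarizing_isThresholdLowerBound`) | CERTIFIED (kernel), unconditional |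

HONEST FRAMING: certified LOWER bounds at the kernel certificate `μ(ℤ²) ≤ 2.6939`; sector-wise (correlation-blind)
decoding for the depolarizing channel; the optimal-decoder numbers of the surface code are numerics, not claimed; the
numerical minimum-weight value `p_{c0} = .1031 ± .0001` (Wang–Harrington–Preskill 2003) is a CLAIM, not asserted.

## References

* [DennisEtAl2002] E. Dennis, A. Kitaev, A. Landahl, J. Preskill, *Topological quantum memory*, J. Math. Phys. 43 (2002)
  4452–4505, arXiv:quant-ph/0110143, §3.1–3.2 (lattice / dual lattice; planar codes), §4.1 (depolarizing channel, X and Z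
  errors corrected separately), §5.3 (eqs. (threshold_2d), (p_c_2d)).
* [LinPryadko2024] H.-K. Lin, L. P. Pryadko, Phys. Rev. A 109 (2024) 022407, arXiv:2306.16400, §4.2 Thm 6
  (permutation-equivalent CSS codes have identical parameters).
* [TillichZemor2014] J.-P. Tillich, G. Zémor, IEEE Trans. IT 60 (2014) 1193, §3 (the surface code as `HGP(H, Hᵀ)`).
* [WangHarringtonPreskill2003] C. Wang, J. Harrington, J. Preskill, Ann. Phys. 303 (2003) 31–58, abstract (`p_{c0} = .1031`).
-/

noncomputable section

namespace Summit.Ventures.QEC.Thresholds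

open Filter Topology Finset Matrix
open Literature.InformationTheory.QuantumCodes
open Literature.InformationTheory.QuantumCodes.PlanarCode
open Literature.Probability.RandomPlanarGeometry

/-! ### The second sector (`H_Z`-checks, smooth edges as boundary) by the coordinate-swap self-duality -/

/-- The qubit coordinate swap of the planar self-duality (both blocks). [cite: TillichZemor2014, §3 (HGP(H, Hᵀ))] -/
abbrev planarQubitSwap (k : ℕ) : PlanarQubit k ≃ PlanarQubit k :=
  (Equiv.sumCongr (Equiv.prodComm (Fin (k + 2)) (Fin (k + 2))) (Equiv.prodComm (Fin (k + 1)) (Fin (k + 1)))).symm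

/-- The check coordinate swap `PlanarCheck k ≃ PlanarZCheck k` of the planar self-duality. [cite: TillichZemor2014, §3] -/
abbrev planarCheckSwap (k : ℕ) : PlanarCheck k ≃ PlanarZCheck k := (Equiv.prodComm (Fin (k + 2)) (Fin (k + 1))).symm

/-- The **pull-back of an `H_Z`-sector decoder to the `H_X`-sector** along the self-duality: `s ↦ D'(s ∘ swap⁻¹) ∘ swap`.
[cite: LinPryadko2024, §4.2 Thm 6 (permutation-equivalent codes)] -/
def planarPullback (k : ℕ) (D' : Decoder (PlanarZCheck k → ZMod 2) (PlanarQubit k → ZMod 2)) :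
    Decoder (PlanarCheck k → ZMod 2) (PlanarQubit k → ZMod 2) :=
  fun s => D' (s ∘ ⇑(planarCheckSwap k).symm) ∘ ⇑(planarQubitSwap k)

/-- **The `H_Z`-sector failure probability of `D'` IS the `H_X`-sector failure probability of its pull-back** (every `k`,
every `p`): the exchange `(planarHGPCode k).swap` is the planar code re-indexed by the coordinate swaps
(`planarHGPCode_swap_eq_reindex`), and code-capacity failure sums are preserved by pull-back (`CSSCode.zFailure_pullback`).
[cite: LinPryadko2024, §4.2 Thm 6] [cite: DennisEtAl2002, §3.1 (lattice and dual lattice)] -/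
theorem planarFailureFamily'_eq_pullback (D' : ∀ k, Decoder (PlanarZCheck k → ZMod 2) (PlanarQubit k → ZMod 2))
    (k : ℕ) (p : ℝ) : planarFailureFamily' D' k p = planarFailureFamily (fun k => planarPullback k (D' k)) k p := by
  have hx := congrFun (congrFun (xFailureFamily_planarHGPCode D') k) p
  have hz := congrFun (congrFun (zFailureFamily_planarHGPCode fun k => planarPullback k (D' k)) k) p
  rw [← hx, ← hz]
  simp only [xFailureFamily, zFailureFamily]
  convert CSSCode.zFailure_pullback (planarHGPCode k) (planarCheckSwap k)
    (Equiv.prodComm (Fin (k + 1)) (Fin (k + 2))).symm (planarQubitSwap k) (D' k) p using 6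
  all_goals first | rfl | (rw [← planarHGPCode_swap_eq_reindex]; rfl)

/-- **Minimum weight is preserved by the pull-back**: a minimum-weight decoder of the `H_Z`-sector pulls back to a
minimum-weight decoder of the `H_X`-sector. [cite: LinPryadko2024, §4.2 Thm 6 (weights are permutation invariant)] -/
theorem planarPullback_isMinWeight (k : ℕ) {D' : Decoder (PlanarZCheck k → ZMod 2) (PlanarQubit k → ZMod 2)}
    (hD' : D'.IsMinWeight (fun e => planarHZ k *ᵥ e) {x | planarHZ k *ᵥ x = 0} hammingNorm) :
    (planarPullback k D').IsMinWeight (fun e => planarHX k *ᵥ e) {x | planarHX k *ᵥ x = 0} hammingNorm := by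
  have hD'' : D'.IsMinWeight ((planarHGPCode k).reindex (planarCheckSwap k)
      (Equiv.prodComm (Fin (k + 1)) (Fin (k + 2))).symm (planarQubitSwap k)).zSyndrome
      (((planarHGPCode k).reindex (planarCheckSwap k) (Equiv.prodComm (Fin (k + 1)) (Fin (k + 2))).symm
        (planarQubitSwap k)).kerX : Set (PlanarQubit k → ZMod 2)) hammingNorm := by
    rw [← planarHGPCode_swap_eq_reindex]
    exact ⟨fun e => by
      rw [SetLike.mem_coe, CSSCode.mem_kerX_iff]
      exact hD'.add_mem e, hD'.weight_le⟩
  have h := (planarHGPCode k).isMinWeight_zPullback _ _ _ hD''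
  exact ⟨fun e => by
    have := h.add_mem e
    rwa [SetLike.mem_coe, CSSCode.mem_kerX_iff] at this, h.weight_le⟩

/-- **Transfer principle**: a threshold bound valid for EVERY minimum-weight decoder family of the `H_X`-sector holds for
every minimum-weight decoder family of the `H_Z`-sector. [cite: LinPryadko2024, §4.2 Thm 6] [cite: DennisEtAl2002, §3.1] -/
theorem planar_isThresholdLowerBound'_of_unprimed {p₀ : ℝ}
    (h : ∀ D : ∀ k, Decoder (PlanarCheck k → ZMod 2) (PlanarQubit k → ZMod 2),
      (∀ k, (D k).IsMinWeight (fun e => planarHX k *ᵥ e) {x | planarHX k *ᵥ x = 0} hammingNorm) →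
        IsThresholdLowerBound (planarFailureFamily D) p₀)
    (D' : ∀ k, Decoder (PlanarZCheck k → ZMod 2) (PlanarQubit k → ZMod 2))
    (hD' : ∀ k, (D' k).IsMinWeight (fun e => planarHZ k *ᵥ e) {x | planarHZ k *ᵥ x = 0} hammingNorm) :
    IsThresholdLowerBound (planarFailureFamily' D') p₀ := by
  have hfam : planarFailureFamily' D' = planarFailureFamily (fun k => planarPullback k (D' k)) := by
    funext k p
    exact planarFailureFamily'_eq_pullback D' k p
  rw [hfam]
  exact h _ fun k => planarPullback_isMinWeight k (hD' k)

/-- ★ **Second sector: planar threshold `≥ p₀(2.6939)`** for every minimum-weight decoder family of the `H_Z`-sector —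
UNCONDITIONAL, tier CERTIFIED (kernel). [cite: DennisEtAl2002, §3.1 and §5.3 eq. (threshold_2d)] -/
theorem planar_isThresholdLowerBound'_kernelSymmK16 (D' : ∀ k, Decoder (PlanarZCheck k → ZMod 2) (PlanarQubit k → ZMod 2))
    (hD' : ∀ k, (D' k).IsMinWeight (fun e => planarHZ k *ᵥ e) {x | planarHZ k *ᵥ x = 0} hammingNorm) :
    IsThresholdLowerBound (planarFailureFamily' D') (thresholdValue 2.6939) :=
  planar_isThresholdLowerBound'_of_unprimed planar_isThresholdLowerBound_kernelSymmK16 D' hD'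

/-- **`p_c > .0357` for the `H_Z`-sector** of the planar surface codes, every minimum-weight decoder family — UNCONDITIONAL,
tier CERTIFIED (kernel). [cite: DennisEtAl2002, §3.1 and §5.3 eq. (p_c_2d)] -/
theorem planar_accuracyThreshold'_gt_0357 (D' : ∀ k, Decoder (PlanarZCheck k → ZMod 2) (PlanarQubit k → ZMod 2))
    (hD' : ∀ k, (D' k).IsMinWeight (fun e => planarHZ k *ᵥ e) {x | planarHZ k *ᵥ x = 0} hammingNorm) :
    (0.0357 : ℝ) < accuracyThreshold (planarFailureFamily' D') :=
  lt_of_lt_of_le thresholdValue_26939_bounds.1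
    (le_accuracyThreshold (planar_isThresholdLowerBound'_kernelSymmK16 D' hD')
      ((thresholdValue_le_half _).trans (by norm_num)))

/-- **Second sector, boundary MWPM** (smooth edge as boundary): threshold `≥ p₀(2.6939)` for every boundary-MWPM family of
the `H_Z`-sector — UNCONDITIONAL, tier CERTIFIED (kernel). [cite: DennisEtAl2002, §5.1 and §5.3] -/
theorem planar_mwpm_isThresholdLowerBound'_kernelSymmK16 {ι : ∀ k, PlanarQubit k → Sym2 (Option (PlanarZCheck k))}
    (hι : ∀ k, IsGraphlikeVia (planarHZ k) (ι k)) (m : ∀ k, EdgeMetric (ι k))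
    {D' : ∀ k, Decoder (Option (PlanarZCheck k) → ZMod 2) (PlanarQubit k → ZMod 2)}
    (hD : ∀ k, IsMatchingDecoder (m k) (D' k)) :
    IsThresholdLowerBound (planarFailureFamily' fun k => boundaryDecoder (D' k)) (thresholdValue 2.6939) :=
  planar_isThresholdLowerBound'_kernelSymmK16 _ fun k => isMinWeight_boundaryDecoder (hι k) (hD k)

/-! ### Both sectors; depolarizing noise -/

/-- **Both sectors at once**: below `p₀(2.6939)` (in particular for every `p < .0357`) every pair of minimum-weight decoder
families (one per sector) of the planar surface codes has BOTH logical failure probabilities `→ 0` — UNCONDITIONAL,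
tier CERTIFIED (kernel). [cite: DennisEtAl2002, §4.1 (X and Z errors corrected separately) and §5.3] -/
theorem planar_bothSectors_belowThreshold_0357
    (DZ : ∀ k, Decoder (PlanarCheck k → ZMod 2) (PlanarQubit k → ZMod 2))
    (hDZ : ∀ k, (DZ k).IsMinWeight (fun e => planarHX k *ᵥ e) {x | planarHX k *ᵥ x = 0} hammingNorm)
    (DX : ∀ k, Decoder (PlanarZCheck k → ZMod 2) (PlanarQubit k → ZMod 2))
    (hDX : ∀ k, (DX k).IsMinWeight (fun e => planarHZ k *ᵥ e) {x | planarHZ k *ᵥ x = 0} hammingNorm)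
    {p : ℝ} (hp₀ : 0 ≤ p) (hpp : p < 0.0357) :
    BelowThreshold (planarFailureFamily DZ) p ∧ BelowThreshold (planarFailureFamily' DX) p :=
  ⟨planar_isThresholdLowerBound_0357 DZ hDZ p hp₀ hpp,
    (planar_isThresholdLowerBound'_kernelSymmK16 DX hDX).anti thresholdValue_26939_bounds.1.le p hp₀ hpp⟩

/-- ★ **Depolarizing threshold `≥ (3/2)·p₀(2.6939)` for the planar surface codes**, decoded sector-wise by ANY pair of
minimum-weight decoder families — UNCONDITIONAL, tier CERTIFIED (kernel) (the two sector thresholds + the `3/2` rule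
`depolarizing_isThresholdLowerBound`; was `(3/2)·p₀(3)`). [cite: DennisEtAl2002, §4.1 (depolarizing channel; X and Z errors corrected separately)] -/
theorem planar_depolarizing_isThresholdLowerBound_kernelSymmK16
    (DX : ∀ k, Decoder (PlanarZCheck k → ZMod 2) (PlanarQubit k → ZMod 2))
    (DZ : ∀ k, Decoder (PlanarCheck k → ZMod 2) (PlanarQubit k → ZMod 2))
    (hDX : ∀ k, (DX k).IsMinWeight (fun e => planarHZ k *ᵥ e) {x | planarHZ k *ᵥ x = 0} hammingNorm)
    (hDZ : ∀ k, (DZ k).IsMinWeight (fun e => planarHX k *ᵥ e) {x | planarHX k *ᵥ x = 0} hammingNorm) :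
    IsThresholdLowerBound (depolarizingFailureFamily (fun k => planarHGPCode k) DX DZ)
      (3 / 2 * thresholdValue 2.6939) := by
  have hX : IsThresholdLowerBound (xFailureFamily (fun k => planarHGPCode k) DX) (thresholdValue 2.6939) := by
    rw [xFailureFamily_planarHGPCode]
    exact planar_isThresholdLowerBound'_kernelSymmK16 DX hDX
  have hZ : IsThresholdLowerBound (zFailureFamily (fun k => planarHGPCode k) DZ) (thresholdValue 2.6939) := by
    rw [zFailureFamily_planarHGPCode]
    exact planar_isThresholdLowerBound_kernelSymmK16 DZ hDZ
  have h := depolarizing_isThresholdLowerBound (fun k => planarHGPCode k) DX DZ hX hZ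
    ((min_le_left _ _).trans (thresholdValue_le_two_thirds _))
  rwa [min_self] at h

/-- ★ **`p_c^depol(planar) > .0535`** (decimal, kernel; was `.0427`) for the planar surface codes under sector-wise
minimum-weight decoding of depolarizing noise (`(3/2) · .0357 = .05355`). [cite: DennisEtAl2002, §4.1 and §5.3 eq. (p_c_2d)] -/
theorem planar_depolarizing_accuracyThreshold_gt_0535
    (DX : ∀ k, Decoder (PlanarZCheck k → ZMod 2) (PlanarQubit k → ZMod 2))
    (DZ : ∀ k, Decoder (PlanarCheck k → ZMod 2) (PlanarQubit k → ZMod 2))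
    (hDX : ∀ k, (DX k).IsMinWeight (fun e => planarHZ k *ᵥ e) {x | planarHZ k *ᵥ x = 0} hammingNorm)
    (hDZ : ∀ k, (DZ k).IsMinWeight (fun e => planarHX k *ᵥ e) {x | planarHX k *ᵥ x = 0} hammingNorm) :
    (0.0535 : ℝ) < accuracyThreshold (depolarizingFailureFamily (fun k => planarHGPCode k) DX DZ) := by
  have h := thresholdValue_26939_bounds.1
  refine lt_of_lt_of_le (by linarith)
    (le_accuracyThreshold (planar_depolarizing_isThresholdLowerBound_kernelSymmK16 DX DZ hDX hDZ) ?_)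
  have := thresholdValue_le_half (2.6939 : ℝ)
  linarith

/-- Canonical instance: minimum-weight decoding of both syndromes of the planar surface codes has depolarizing threshold
`> .0535`. [cite: DennisEtAl2002, §4.1 and §5.1] -/
theorem planar_depolarizing_accuracyThreshold_minWeight_gt_0535 :
    (0.0535 : ℝ) < accuracyThreshold
      (depolarizingFailureFamily (fun k => planarHGPCode k)
        (fun k => Decoder.minWeight (fun e : PlanarQubit k → ZMod 2 => planarHZ k *ᵥ e) hammingNorm)
        fun k => Decoder.minWeight (fun e : PlanarQubit k → ZMod 2 => planarHX k *ᵥ e) hammingNorm) :=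
  planar_depolarizing_accuracyThreshold_gt_0535 _ _
    (fun k => (planarHGPCode k).isMinWeight_minWeight_xSyndrome) fun k => planar_isMinWeight_minWeight k

end Summit.Ventures.QEC.Thresholds
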